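import Literature.MathematicalPhysics.StatisticalMechanics.NJLHoppingLocality
import HarnessLib

/-!
# The thermodynamic limit of the NJL system and its analyticity in the mass
# (Salmhofer–Seiler, CMP 139 (1991), Thm. 3.8 and Cor. 3.9 — unconditional, torus version)

Salmhofer–Seiler, p. 407:

* **Theorem 3.8.** "Let `⟨·⟩_Λ` be the expectation value of the NJL model on `Λ ⊂ ℤ^ν` and `L` a
  finite multiindex. (1) For all `m ∈ 𝒲`, the thermodynamic limit `⟨σ^L⟩ = lim_{Λ→∞} ⟨σ^L⟩_Λ`
  (3.31) exists if `Λ → ∞` in the sense of Van Hove. (2) `⟨σ^L⟩` is an analytic function of `m` on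
  `𝒲`. *Proof.* By Remark 3.2, the NJL system on `Λ` is an ordinary monomer-dimer system on a graph
  `Γ(Λ)` with vertex set `V(Γ(Λ)) = Λ × {1,…,N}`. The proof of the statement for these systems is
  contained in [20], see also [28]."  (`𝒲 = ℂ ∖ 2i[-√(2νN), √(2νN)]`.)
* **Corollary 3.9.** "Let `m ∈ ℝ`. A phase transition can occur in a NJL model only if `m = 0`.
  For `m ≠ 0`, all correlation functions are analytic in `m`."
* **Remark 3.10.** "… the expansion in the hopping parameter `κ = 1/2m` … The radius of convergence
  of the expansion is, however, at least `(2√(2νN))⁻¹`."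

The tree had all of this MODULO the convergence of `⟨σ^d⟩_Λ(m)` at large real `m`
(`NJLMassAnalyticity`: zero-freeness (Thm. 3.6), the Erratum's volume-independent bounds, Montel and
Vitali give `exists_tendstoLocallyUniformlyOn_njlCorrelation_of_tendsto_real`).  This file removes
the condition, for the volumes of this series — the discrete tori `Λ_L = (ℤ/Lℤ)^ν`, `L → ∞` along
ANY sequence:

1. `njlHopping_sub_isBigO` — the locality of the hopping expansion (`NJLHoppingLocality`:
   `⟨σ^d⟩_{Λ₁}(m) - ⟨σ^d⟩_{Λ₂}(m) = O(|m|^{-n})` for all tori wider than `2R(d,n)`), read in the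
   hopping parameter `K = 1/(2m)`: the difference of the hopping functions of two large tori is
   `O(K^n)` at `K = 0`.
2. `norm_njlHopping_sub_le` — with the volume-independent majorant `|⟨σ^d⟩_Λ(1/2K)| ≤ (2|K|)^{|d|} ≤ 1`
   on the hopping disc `|K| < r₀ = (2√(2ν))⁻¹` (Remark 3.10, `norm_njlHopping_le`), Mathlib's
   Schwarz lemma of order `n` (`Complex.dist_le_mul_div_pow_of_mapsTo_ball_of_isLittleO`) gives
   `|⟨σ^d⟩_{Λ₁} - ⟨σ^d⟩_{Λ₂}| ≤ 2 (|K|/r₀)^{n+1}` on the disc, for all tori wider than `2R(d,n)`: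
   the finite-volume correlations are CAUCHY in the volume at every mass `|m| > √(2ν)`
   (`njlHopping_cauchy`, `exists_tendsto_njlCorrelation_real`).
3. `njl_thermodynamicLimit` — **Theorem 3.8 (1)–(2)**: for every `N ≥ 1`, `ν ≥ 1` and every
   multi-index `d` on `ℤ^ν` there is ONE function `⟨σ^d⟩(m)`, holomorphic on
   `ℂ ∖ i[-√(2ν), √(2ν)] ⊇ 𝒲`, to which `⟨σ^d⟩_{Λ_{L_n}}(m)` converges locally uniformly for EVERY
   sequence of tori with `L_n → ∞` (Vitali from step 2; independence of the sequence by the identity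
   transport of `VitaliIdentityTransport`).  Corollaries: `njl_thermodynamicLimit_succ` (the
   sequence `L = 1, 2, 3, …`), `njl_thermodynamicLimit_analyticOnNhd` (Thm. 3.8 (2)),
   `njl_thermodynamicLimit_real` (**Corollary 3.9**: for every real `m ≠ 0` the limit exists and is
   the value of a function holomorphic on the region — real-analytic on `ℝ ∖ {0}`, both signs).

Faithfulness / scope.  (i) Volumes: the print has van Hove sequences `Λ ⊂ ℤ^ν` (free boundary
conditions); the tree's NJL system lives on tori (this whole series uses reflection positivity), and
the theorem here is the torus version `Λ_L = (ℤ/Lℤ)^ν`, `L → ∞` — TODO(general form): van Hove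
sequences of subsets.  (ii) Region: the tree's zero-free region `ℂ ∖ i[-√(2ν), √(2ν)]` contains the
printed `𝒲` (`printedRegion_subset_njlMassRegion`), so nothing is weakened.  (iii) Road: the print
cites the Gruber–Kunz Mayer expansion [20]; here the large-mass convergence comes from the
Heilmann–Lieb recursion (locality) + the Erratum's bound + Schwarz, and the extension to the whole
region is the tree's Vitali argument — the same statement by a shorter road.  (iv) Honest framing:
`β = 0` NJL / monomer–dimer statements on finite tori and their `L → ∞` limit; nothing about
`β > 0`, the continuum, a mass gap or the summit's `QCD` conjunct.

## References

* M. Salmhofer, E. Seiler, *Proof of chiral symmetry breaking in strongly coupled lattice gauge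
  theory*, Commun. Math. Phys. 139 (1991) 395–432: Thm. 3.8, Cor. 3.9, Remark 3.10, p. 407.
  [SalmhoferSeiler1991]
* M. Salmhofer, E. Seiler, Erratum, Commun. Math. Phys. 146 (1992) 637–638. [SalmhoferSeiler1992Erratum]
* C. Gruber, H. Kunz, *General properties of polymer systems*, Commun. Math. Phys. 22 (1971)
  133–161 (SS91's [20]). [GruberKunz1971]
* O. J. Heilmann, E. H. Lieb, *Theory of monomer-dimer systems*, Commun. Math. Phys. 25 (1972)
  190–232. [HeilmannLieb1972]
-/

noncomputable section

open Filter Asymptotics Bornology Topology Metric Set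

namespace Literature.MathematicalPhysics.StatisticalMechanics

namespace ComplexSpin

open Literature.Probability.LatticeModels (TorusSite Site)
open Literature.Probability.LatticeModels

variable {ν : ℕ}

/-! ### The hopping disc -/

/-- `√(2ν) > 1` for `ν ≥ 1`. [folklore] -/
private theorem one_lt_sqrt_two_mul (hν : 1 ≤ ν) : 1 < Real.sqrt (2 * ν) := by
  have h : (1 : ℝ) < 2 * ν := by
    have : (1 : ℝ) ≤ ν := by exact_mod_cast hν
    linarith
  calc (1 : ℝ) = Real.sqrt 1 := Real.sqrt_one.symm
    _ < Real.sqrt (2 * ν) := Real.sqrt_lt_sqrt (by norm_num) h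

/-- The hopping radius `r₀ = (2√(2ν))⁻¹` is positive (`ν ≥ 1`). [cite: SalmhoferSeiler1991, Remark 3.10] -/
theorem hoppingRadius_pos (hν : 1 ≤ ν) : 0 < (2 * Real.sqrt (2 * (ν : ℝ)))⁻¹ := by
  have := one_lt_sqrt_two_mul hν
  positivity

/-- `2 r₀ < 1` (`ν ≥ 1`): on the hopping disc `2|K| < 1`. [cite: SalmhoferSeiler1991, Remark 3.10] -/
theorem two_mul_hoppingRadius_lt_one (hν : 1 ≤ ν) : 2 * (2 * Real.sqrt (2 * (ν : ℝ)))⁻¹ < 1 := by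
  have h := one_lt_sqrt_two_mul hν
  have hs : 0 < Real.sqrt (2 * ν) := by linarith
  rw [mul_inv, ← mul_assoc, mul_inv_cancel₀ (two_ne_zero' ℝ), one_mul]
  exact inv_lt_one_of_one_lt₀ h

/-- Off `K = 0` the hopping function is the correlation at mass `1/(2K)`. [cite: SalmhoferSeiler1991, Remark 3.10] -/
theorem njlHopping_eq_of_ne_zero (N L : ℕ) [NeZero L] (d : Site ν →₀ ℕ) {K : ℂ} (hK : K ≠ 0) :
    njlHopping N L d K = njlCorrelation N L d (2 * K)⁻¹ := by
  simp [njlHopping, Function.update_of_ne hK]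

/-- At `K = 0` the hopping function is `1` for the empty monomial and `0` otherwise, in every volume.
[cite: SalmhoferSeiler1991, Remark 3.10] -/
theorem njlHopping_zero (N L : ℕ) [NeZero L] (d : Site ν →₀ ℕ) :
    njlHopping N L d 0 = if d = 0 then 1 else 0 := by
  simp [njlHopping]

/-- The empty correlation is `1` wherever `Z_Λ(m) ≠ 0`. [cite: SalmhoferSeiler1991, (3.2)] -/
theorem njlCorrelation_zero_eq_one (N L : ℕ) [NeZero L] {m : ℂ}
    (hZ : njlPartitionFunctionC (ν := ν) (L := L) N m ≠ 0) :
    njlCorrelation (ν := ν) N L 0 m = 1 := by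
  unfold njlCorrelation njlExpectC
  rw [Finsupp.mapDomain_zero, MvPolynomial.monomial_zero', MvPolynomial.C_1]
  exact div_self hZ

/-- Inside the hopping disc, `K ≠ 0`, the mass `1/(2K)` has `√(2ν) < |1/(2K)|`. [cite: SalmhoferSeiler1991, (3.28) and Remark 3.10] -/
theorem sqrt_lt_norm_inv_two_mul {K : ℂ} (hK0 : K ≠ 0) (hK : ‖K‖ < (2 * Real.sqrt (2 * (ν : ℝ)))⁻¹) :
    Real.sqrt (2 * ν) < ‖(2 * K : ℂ)⁻¹‖ := by
  have hKpos : 0 < ‖K‖ := norm_pos_iff.2 hK0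
  have h2K : ‖(2 * K : ℂ)⁻¹‖ = (2 * ‖K‖)⁻¹ := by simp
  rw [h2K]
  rcases (Real.sqrt_nonneg (2 * ν)).eq_or_lt with hs | hs
  · rw [← hs]; positivity
  · rw [lt_inv_comm₀ hs (by positivity)]
    calc 2 * ‖K‖ < 2 * (2 * Real.sqrt (2 * ν))⁻¹ := by linarith
      _ = (Real.sqrt (2 * ν))⁻¹ := by rw [mul_inv, ← mul_assoc, mul_inv_cancel₀ (two_ne_zero' ℝ), one_mul]

/-- **The uniform majorant on the hopping disc**: `|⟨σ^d⟩_Λ(1/2K)| ≤ 1` for `|K| < r₀`, every volume,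
every multi-index (`N ≥ 1`, `ν ≥ 1`). [cite: SalmhoferSeiler1991, Remark 3.10][cite: SalmhoferSeiler1992Erratum, (5)] -/
theorem norm_njlHopping_le_one {N : ℕ} (hN : 1 ≤ N) (hν : 1 ≤ ν) (L : ℕ) [NeZero L]
    (d : Site ν →₀ ℕ) {K : ℂ} (hK : ‖K‖ < (2 * Real.sqrt (2 * (ν : ℝ)))⁻¹) : ‖njlHopping N L d K‖ ≤ 1 := by
  by_cases hd : d = 0
  · subst hd
    by_cases hK0 : K = 0
    · subst hK0; simp [njlHopping_zero]
    · rw [njlHopping_eq_of_ne_zero N L 0 hK0, njlCorrelation_zero_eq_one N L]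
      · simp
      · exact njlPartitionFunctionC_ne_zero_of_sqrt_le_norm N
          (inv_ne_zero (mul_ne_zero two_ne_zero hK0)) (sqrt_lt_norm_inv_two_mul hK0 hK).le
  · refine (norm_njlHopping_le hN L hd hK).trans (pow_le_one₀ (by positivity) ?_)
    have := two_mul_hoppingRadius_lt_one hν
    linarith

/-! ### Step 1: locality read in the hopping parameter -/

/-- `K ↦ 1/(2K)` sends the punctured neighbourhood of `0` to `|m| → ∞`. [folklore] -/
private theorem tendsto_inv_two_mul :
    Tendsto (fun K : ℂ => (2 * K)⁻¹) (𝓝[≠] (0 : ℂ)) (cobounded ℂ) := by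
  have h2 : Tendsto (fun K : ℂ => 2 * K) (𝓝[≠] (0 : ℂ)) (𝓝[≠] (0 : ℂ)) := by
    refine tendsto_nhdsWithin_iff.2 ⟨?_, ?_⟩
    · have : Tendsto (fun K : ℂ => 2 * K) (𝓝 0) (𝓝 (2 * 0)) :=
        (continuous_const.mul continuous_id).tendsto 0
      rw [mul_zero] at this
      exact this.mono_left nhdsWithin_le_nhds
    · filter_upwards [self_mem_nhdsWithin] with K hK
      exact mul_ne_zero two_ne_zero hK
  exact tendsto_inv₀_nhdsNE_zero.comp h2

/-- **Locality in the hopping parameter.**  For the NJL system (`N ≥ 1`), a multi-index `d ≤ N` and an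
order `n` there is a size `R` such that for all tori `Λ₁`, `Λ₂` wider than `2R` the hopping functions
satisfy `⟨σ^d⟩_{Λ₁}(1/2K) - ⟨σ^d⟩_{Λ₂}(1/2K) = O(K^n)` as `K → 0`: their hopping-parameter expansions
agree to order `n`. [cite: SalmhoferSeiler1991, Remark 3.10 and Thm. 3.8 (1)][cite: GruberKunz1971, §3] -/
theorem njlHopping_sub_isBigO {N : ℕ} (hN : 1 ≤ N) {d : Site ν →₀ ℕ} (hd : ∀ x, d x ≤ N) (n : ℕ) :
    ∃ R : ℕ, ∀ (L₁ L₂ : ℕ) [NeZero L₁] [NeZero L₂], 2 * R < L₁ → 2 * R < L₂ →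
      (fun K => njlHopping N L₁ d K - njlHopping N L₂ d K) =O[𝓝[≠] (0 : ℂ)] fun K : ℂ => K ^ n := by
  obtain ⟨R, hR⟩ := exists_njlCorrelation_sub_isBigO hN hd n
  refine ⟨R, fun L₁ L₂ _ _ hL₁ hL₂ => ?_⟩
  have h := (hR L₁ L₂ hL₁ hL₂).comp_tendsto tendsto_inv_two_mul
  -- rewrite the hopping functions and the gauge
  have h' : (fun K => njlHopping N L₁ d K - njlHopping N L₂ d K) =O[𝓝[≠] (0 : ℂ)]
      fun K : ℂ => (‖(2 * K : ℂ)⁻¹‖⁻¹ ^ n : ℝ) := by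
    refine h.congr' ?_ EventuallyEq.rfl
    filter_upwards [self_mem_nhdsWithin] with K hK
    simp only [Function.comp_apply]
    rw [njlHopping_eq_of_ne_zero N L₁ d hK, njlHopping_eq_of_ne_zero N L₂ d hK]
  refine h'.trans (IsBigO.of_bound (2 ^ n) (Eventually.of_forall fun K => ?_))
  rw [norm_inv, inv_inv, norm_mul, Complex.norm_two, Real.norm_of_nonneg (by positivity),
    norm_pow, mul_pow]

/-! ### Step 2: Schwarz — the correlations are Cauchy in the volume on the hopping disc -/

/-- **Two large tori differ by `2(|K|/r₀)^{n+1}` on the hopping disc.**  For the NJL system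
(`N, ν ≥ 1`), a multi-index `d ≤ N` and an order `n` there is a size `R` such that for all tori
`Λ₁`, `Λ₂` wider than `2R` and all `|K| < r₀`,
`|⟨σ^d⟩_{Λ₁}(1/2K) - ⟨σ^d⟩_{Λ₂}(1/2K)| ≤ 2 (|K|/r₀)^{n+1}` (locality to order `n+1`, the uniform
majorant `1`, and the Schwarz lemma of order `n`). [cite: SalmhoferSeiler1991, Remark 3.10 and Thm. 3.8 (1)][cite: SalmhoferSeiler1992Erratum, (5)] -/
theorem norm_njlHopping_sub_le {N : ℕ} (hN : 1 ≤ N) (hν : 1 ≤ ν) {d : Site ν →₀ ℕ}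
    (hd : ∀ x, d x ≤ N) (n : ℕ) :
    ∃ R : ℕ, ∀ (L₁ L₂ : ℕ) [NeZero L₁] [NeZero L₂], 2 * R < L₁ → 2 * R < L₂ →
      ∀ K : ℂ, ‖K‖ < (2 * Real.sqrt (2 * (ν : ℝ)))⁻¹ →
        ‖njlHopping N L₁ d K - njlHopping N L₂ d K‖ ≤ 2 * (‖K‖ / (2 * Real.sqrt (2 * (ν : ℝ)))⁻¹) ^ (n + 1) := by
  obtain ⟨R, hR⟩ := njlHopping_sub_isBigO hN hd (n + 1)
  refine ⟨R, fun L₁ L₂ _ _ hL₁ hL₂ K hK => ?_⟩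
  set r₀ : ℝ := (2 * Real.sqrt (2 * (ν : ℝ)))⁻¹ with hr₀
  set F : ℂ → ℂ := fun K => njlHopping N L₁ d K - njlHopping N L₂ d K with hF
  have hF0 : F 0 = 0 := by simp [hF, njlHopping_zero]
  have hFd : DifferentiableOn ℂ F (ball 0 r₀) :=
    (differentiableOn_njlHopping hN L₁ d).sub (differentiableOn_njlHopping hN L₂ d)
  have hmaps : MapsTo F (ball 0 r₀) (closedBall (F 0) 2) := by
    intro w hw
    rw [mem_ball_zero_iff] at hw
    rw [mem_closedBall, hF0, dist_zero_right]
    calc ‖F w‖ ≤ ‖njlHopping N L₁ d w‖ + ‖njlHopping N L₂ d w‖ := norm_sub_le _ _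
      _ ≤ 1 + 1 := add_le_add (norm_njlHopping_le_one hN hν L₁ d hw) (norm_njlHopping_le_one hN hν L₂ d hw)
      _ = 2 := by norm_num
  -- `F = O(K^{n+1}) = o(‖K‖^n)` at `0`
  have hO : F =O[𝓝[≠] (0 : ℂ)] fun K : ℂ => K ^ (n + 1) := hR L₁ L₂ hL₁ hL₂
  have ho : (fun K => F K - F 0) =o[𝓝 (0 : ℂ)] fun w => ‖w - 0‖ ^ n := by
    have h1 : F =o[𝓝[≠] (0 : ℂ)] fun w : ℂ => ‖w - 0‖ ^ n := by
      have hpp : (fun K : ℂ => K ^ (n + 1)) =o[𝓝[≠] (0 : ℂ)] fun K : ℂ => K ^ n :=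
        (isLittleO_pow_pow (Nat.lt_succ_self n)).mono nhdsWithin_le_nhds
      refine (hO.trans_isLittleO hpp).trans_isBigO (isBigO_of_le _ fun K => le_of_eq ?_)
      rw [norm_pow, sub_zero, Real.norm_of_nonneg (by positivity)]
    have h2 : (fun K => F K - F 0) =o[𝓝[≠] (0 : ℂ)] fun w : ℂ => ‖w - 0‖ ^ n :=
      h1.congr_left fun K => by rw [hF0, sub_zero]
    have h3 := h2.insert (show F 0 - F 0 = 0 from sub_self _)
    rwa [nhdsWithin_insert, pure_sup_nhdsNE] at h3
  have key := Complex.dist_le_mul_div_pow_of_mapsTo_ball_of_isLittleO hFd hmaps ho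
    (mem_ball_zero_iff.2 hK)
  rwa [hF0, dist_zero_right, dist_zero_right] at key

/-- **The correlations are Cauchy in the volume on the hopping disc**: for `|K| < r₀` and `ε > 0`
there is `R` with `|⟨σ^d⟩_{Λ₁}(1/2K) - ⟨σ^d⟩_{Λ₂}(1/2K)| < ε` for all tori wider than `2R`
(`N, ν ≥ 1`, `d ≤ N`). [cite: SalmhoferSeiler1991, Thm. 3.8 (1) and Remark 3.10] -/
theorem njlHopping_cauchy {N : ℕ} (hN : 1 ≤ N) (hν : 1 ≤ ν) {d : Site ν →₀ ℕ} (hd : ∀ x, d x ≤ N)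
    {K : ℂ} (hK : ‖K‖ < (2 * Real.sqrt (2 * (ν : ℝ)))⁻¹) {ε : ℝ} (hε : 0 < ε) :
    ∃ R : ℕ, ∀ (L₁ L₂ : ℕ) [NeZero L₁] [NeZero L₂], 2 * R < L₁ → 2 * R < L₂ →
      ‖njlHopping N L₁ d K - njlHopping N L₂ d K‖ < ε := by
  have hr₀ := hoppingRadius_pos hν
  have hq0 : 0 ≤ ‖K‖ / (2 * Real.sqrt (2 * (ν : ℝ)))⁻¹ := by positivity
  have hq1 : ‖K‖ / (2 * Real.sqrt (2 * (ν : ℝ)))⁻¹ < 1 := (div_lt_one hr₀).2 hK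
  obtain ⟨n, hn⟩ := exists_pow_lt_of_lt_one (show 0 < ε / 2 by positivity) hq1
  obtain ⟨R, hR⟩ := norm_njlHopping_sub_le hN hν hd n
  refine ⟨R, fun L₁ L₂ _ _ hL₁ hL₂ => (hR L₁ L₂ hL₁ hL₂ K hK).trans_lt ?_⟩
  have : (‖K‖ / (2 * Real.sqrt (2 * (ν : ℝ)))⁻¹) ^ (n + 1) ≤ (‖K‖ / (2 * Real.sqrt (2 * (ν : ℝ)))⁻¹) ^ n :=
    pow_le_pow_of_le_one hq0 hq1.le (Nat.le_succ n)
  linarith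

/-- **Convergence on the hopping disc, every sequence of volumes.**  For `|K| < r₀` there is ONE
number `c` such that `⟨σ^d⟩_{Λ_{L_j}}(1/2K) → c` for every sequence of tori with `L_j → ∞`
(`N, ν ≥ 1`, `d ≤ N`). [cite: SalmhoferSeiler1991, Thm. 3.8 (1) and Remark 3.10] -/
theorem exists_tendsto_njlHopping {N : ℕ} (hN : 1 ≤ N) (hν : 1 ≤ ν) {d : Site ν →₀ ℕ}
    (hd : ∀ x, d x ≤ N) {K : ℂ} (hK : ‖K‖ < (2 * Real.sqrt (2 * (ν : ℝ)))⁻¹) :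
    ∃ c : ℂ, ∀ (Ls : ℕ → ℕ) [∀ j, NeZero (Ls j)], Tendsto Ls atTop atTop →
      Tendsto (fun j => njlHopping N (Ls j) d K) atTop (𝓝 c) := by
  -- the canonical sequence `L = j + 1` is Cauchy
  set u : ℕ → ℂ := fun j => njlHopping N (j + 1) d K with hu
  have hcau : CauchySeq u := by
    refine Metric.cauchySeq_iff.2 fun ε hε => ?_
    obtain ⟨R, hR⟩ := njlHopping_cauchy hN hν hd hK hε
    refine ⟨2 * R, fun j hj k hk => ?_⟩
    rw [dist_eq_norm]
    exact hR (j + 1) (k + 1) (by omega) (by omega)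
  obtain ⟨c, hc⟩ := cauchySeq_tendsto_of_complete hcau
  refine ⟨c, fun Ls _ hLs => ?_⟩
  rw [Metric.tendsto_atTop]
  intro ε hε
  obtain ⟨R, hR⟩ := njlHopping_cauchy hN hν hd hK (half_pos hε)
  obtain ⟨M₀, hM₀⟩ := (Metric.tendsto_atTop.1 hc) (ε / 2) (half_pos hε)
  obtain ⟨J, hJ⟩ := (hLs.eventually (eventually_gt_atTop (2 * R))).exists_forall_of_atTop
  refine ⟨J, fun j hj => ?_⟩
  set M := max M₀ (2 * R) with hM
  have h1 : ‖njlHopping N (Ls j) d K - u M‖ < ε / 2 := hR (Ls j) (M + 1) (hJ j hj) (by omega)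
  have h2 : dist (u M) c < ε / 2 := hM₀ M (le_max_left _ _)
  rw [dist_eq_norm] at h2 ⊢
  calc ‖njlHopping N (Ls j) d K - c‖
      = ‖(njlHopping N (Ls j) d K - u M) + (u M - c)‖ := by rw [sub_add_sub_cancel]
    _ ≤ ‖njlHopping N (Ls j) d K - u M‖ + ‖u M - c‖ := norm_add_le _ _
    _ < ε / 2 + ε / 2 := add_lt_add h1 h2
    _ = ε := by ring

/-- **Convergence at large real mass (the Vitali input).**  For every real mass `t > √(2ν)` there is
ONE number `c` with `⟨σ^d⟩_{Λ_{L_j}}(t) → c` for every sequence of tori `L_j → ∞` (`N, ν ≥ 1`,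
`d ≤ N`). [cite: SalmhoferSeiler1991, Thm. 3.8 (1)] -/
theorem exists_tendsto_njlCorrelation_real {N : ℕ} (hN : 1 ≤ N) (hν : 1 ≤ ν) {d : Site ν →₀ ℕ}
    (hd : ∀ x, d x ≤ N) {t : ℝ} (ht : Real.sqrt (2 * ν) < t) :
    ∃ c : ℂ, ∀ (Ls : ℕ → ℕ) [∀ j, NeZero (Ls j)], Tendsto Ls atTop atTop →
      Tendsto (fun j => njlCorrelation N (Ls j) d (t : ℂ)) atTop (𝓝 c) := by
  have hs : 0 < Real.sqrt (2 * ν) := lt_trans zero_lt_one (one_lt_sqrt_two_mul hν)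
  have ht0 : 0 < t := hs.trans ht
  set K : ℂ := (((2 * t)⁻¹ : ℝ) : ℂ) with hKdef
  have hK0 : K ≠ 0 := by
    rw [hKdef, Complex.ofReal_ne_zero]; positivity
  have hKnorm : ‖K‖ = (2 * t)⁻¹ := by
    rw [hKdef, Complex.norm_real, Real.norm_of_nonneg (by positivity)]
  have hK : ‖K‖ < (2 * Real.sqrt (2 * (ν : ℝ)))⁻¹ := by
    rw [hKnorm]
    exact inv_strictAnti₀ (by positivity) (by linarith)
  have hm : (2 * K)⁻¹ = (t : ℂ) := by
    rw [hKdef]; push_cast; field_simp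
  obtain ⟨c, hc⟩ := exists_tendsto_njlHopping hN hν hd hK
  refine ⟨c, fun Ls _ hLs => ?_⟩
  have h := hc Ls hLs
  refine h.congr fun j => ?_
  rw [njlHopping_eq_of_ne_zero N (Ls j) d hK0, hm]

/-! ### Multi-indices exceeding the capacity -/

/-- If some `d_x > N` then `⟨σ^d⟩_Λ(m) = 0` in every torus wide enough to embed the support of `d`
(`σ_x^{N+1} = 0`: nilpotency, Remark 3.2). [cite: SalmhoferSeiler1991, Remark 3.2 and Def. 3.7] -/
theorem njlCorrelation_eq_zero_of_lt {N : ℕ} {d : Site ν →₀ ℕ} {x : Site ν} (hx : N < d x) :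
    ∃ R : ℕ, ∀ (L : ℕ) [NeZero L], 2 * R < L → ∀ m : ℂ, njlCorrelation N L d m = 0 := by
  classical
  -- a box containing the support
  obtain ⟨R, -, hbox⟩ : ∃ R : ℕ, 0 ≤ R ∧ ∀ y ∈ d.support, ∀ i, |y i| + ((0 : ℕ) : ℤ) ≤ R := by
    refine ⟨d.support.sup (fun y => Finset.univ.sup fun i => (y i).natAbs), Nat.zero_le _, ?_⟩
    intro y hy i
    have h1 : (y i).natAbs ≤ Finset.univ.sup fun j => (y j).natAbs :=
      Finset.le_sup (f := fun j => (y j).natAbs) (Finset.mem_univ i)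
    have h2 : (Finset.univ.sup fun j => (y j).natAbs) ≤
        d.support.sup fun y => Finset.univ.sup fun j => (y j).natAbs :=
      Finset.le_sup (f := fun y => Finset.univ.sup fun j => (y j).natAbs) hy
    have h3 : |y i| = ((y i).natAbs : ℤ) := (Int.natCast_natAbs (y i)).symm
    rw [h3]; push_cast; omega
  have hboxR : ∀ y ∈ d.support, ∀ i, |y i| ≤ (R : ℤ) := fun y hy i => by
    have := hbox y hy i; push_cast at this; linarith
  refine ⟨R, fun L _ hL m => ?_⟩
  have hxs : x ∈ d.support := Finsupp.mem_support_iff.2 (by omega)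
  have hval : Finsupp.mapDomain (Torus.proj L) d (Torus.proj L x) = d x :=
    Finsupp.mapDomain_apply' {y : Site ν | ∀ i, |y i| ≤ (R : ℤ)} d
      (fun y hy => by exact hboxR y (Finset.mem_coe.1 hy))
      (fun v hv w hw h => torusProj_injOn_box hL hv hw h) (hboxR x hxs)
  have hnot : ¬ Finsupp.mapDomain (Torus.proj L) d ≤ topExponent (ν := ν) (L := L) N := by
    intro hle
    have := hle (Torus.proj L x)
    rw [hval, topExponent_apply'] at this
    omega
  unfold njlCorrelation njlExpectC
  rw [njlBracketC_monomial, if_neg hnot, zero_div]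

/-! ### Theorem 3.8 and Corollary 3.9 -/

/-- **Theorem 3.8 (1)–(2) (Salmhofer–Seiler), torus version, unconditional.**  For the NJL system
with `N ≥ 1` colours in dimension `ν ≥ 1` and every multi-index `d` on `ℤ^ν` there is ONE function
`⟨σ^d⟩ : ℂ → ℂ`, holomorphic on `ℂ ∖ i[-√(2ν), √(2ν)] ⊇ 𝒲`, such that for EVERY sequence of tori
`Λ_j = (ℤ/L_jℤ)^ν` with `L_j → ∞` the finite-volume correlation functions `m ↦ ⟨σ^d⟩_{Λ_j}(m)`
converge to `⟨σ^d⟩` locally uniformly on that region: the thermodynamic limit exists on all of `𝒲`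
and is an analytic function of the mass there. [cite: SalmhoferSeiler1991, Thm. 3.8][cite: GruberKunz1971, §3] -/
theorem njl_thermodynamicLimit {N : ℕ} (hN : 1 ≤ N) (hν : 1 ≤ ν) (d : Site ν →₀ ℕ) :
    ∃ f : ℂ → ℂ, DifferentiableOn ℂ f (njlMassRegion ν) ∧
      ∀ (Ls : ℕ → ℕ) [∀ j, NeZero (Ls j)], Tendsto Ls atTop atTop →
        TendstoLocallyUniformlyOn (fun j => njlCorrelation N (Ls j) d) f atTop (njlMassRegion ν) := by
  classical
  by_cases hd : ∀ x, d x ≤ N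
  · -- real masses in `[a, a+1]`, `a = √(2ν) + 1`: limits exist and do not depend on the sequence
    set a : ℝ := Real.sqrt (2 * ν) + 1 with ha
    have ha0 : 0 < a := by have := Real.sqrt_nonneg (2 * (ν : ℝ)); rw [ha]; linarith
    have hab : a < a + 1 := by linarith
    have hlim : ∀ t ∈ Icc a (a + 1), ∃ c : ℂ, ∀ (Ls : ℕ → ℕ) [∀ j, NeZero (Ls j)],
        Tendsto Ls atTop atTop → Tendsto (fun j => njlCorrelation N (Ls j) d (t : ℂ)) atTop (𝓝 c) :=
      fun t ht => exists_tendsto_njlCorrelation_real hN hν hd (by rw [ha] at ht; linarith [ht.1])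
    have hsucc : Tendsto (fun j : ℕ => j + 1) atTop atTop := tendsto_add_atTop_nat 1
    -- Vitali along the canonical sequence
    obtain ⟨f, hf, hFf⟩ := exists_tendstoLocallyUniformlyOn_njlCorrelation_of_tendsto_real hN d
      (fun j => j + 1) ha0 hab fun t ht => by
        obtain ⟨c, hc⟩ := hlim t ht
        exact ⟨c, hc (fun j => j + 1) hsucc⟩
    refine ⟨f, hf, fun Ls _ hLs => ?_⟩
    -- identity transport: the limit along `Ls` is the same function
    have hz₀ : ((a : ℝ) : ℂ) ∈ njlMassRegion ν := Or.inl (by rw [Complex.ofReal_re]; exact ha0.ne')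
    have hsU : (fun t : ℝ => (t : ℂ)) '' Icc a (a + 1) ⊆ njlMassRegion ν := by
      rintro _ ⟨t, ht, rfl⟩
      exact Or.inl (by rw [Complex.ofReal_re]; linarith [ht.1])
    obtain ⟨g, -, hFg, hGg⟩ := Literature.Analysis.Complex.exists_common_limit_of_agree_on
      isOpen_njlMassRegion isPreconnected_njlMassRegion
      (fun j => differentiableOn_njlCorrelation N (j + 1) d)
      (fun j => differentiableOn_njlCorrelation N (Ls j) d)
      (fun z hz => by
        obtain ⟨M, r, hr, hM⟩ := njlCorrelation_locally_bounded hN d z hz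
        exact ⟨M, r, hr, fun j w hw => hM (j + 1) inferInstance w hw⟩)
      (fun z hz => by
        obtain ⟨M, r, hr, hM⟩ := njlCorrelation_locally_bounded hN d z hz
        exact ⟨M, r, hr, fun j w hw => hM (Ls j) inferInstance w hw⟩)
      hz₀ (Literature.Analysis.Complex.frequently_nhdsNE_ofReal_mem_image_Icc ⟨le_rfl, hab⟩) hsU
      (by
        rintro _ ⟨t, ht, rfl⟩
        obtain ⟨c, hc⟩ := hlim t ht
        exact ⟨c, hc (fun j => j + 1) hsucc, hc Ls hLs⟩)
    -- `f = g` on the region (both are limits of the canonical sequence)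
    have hfg : EqOn g f (njlMassRegion ν) := fun z hz =>
      tendsto_nhds_unique (hFg.tendsto_at hz) (hFf.tendsto_at hz)
    exact hGg.congr_right hfg
  · -- some `d_x > N`: the correlations vanish identically in every large torus
    simp only [not_forall, not_le] at hd
    obtain ⟨x, hx⟩ := hd
    obtain ⟨R, hR⟩ := njlCorrelation_eq_zero_of_lt (ν := ν) hx
    refine ⟨fun _ => 0, differentiableOn_const 0, fun Ls _ hLs => ?_⟩
    refine (tendstoLocallyUniformlyOn_iff_forall_isCompact isOpen_njlMassRegion).2
      fun K _ _ => ?_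
    refine Metric.tendstoUniformlyOn_iff.2 fun ε hε => ?_
    filter_upwards [hLs.eventually (eventually_gt_atTop (2 * R))] with j hj z _
    rw [hR (Ls j) hj z, dist_self]
    exact hε

/-- **Theorem 3.8 along `L = 1, 2, 3, …`.**  The finite-volume correlation functions of the tori
`(ℤ/(L+1)ℤ)^ν` converge, locally uniformly in the mass on `ℂ ∖ i[-√(2ν), √(2ν)]`, to a function
holomorphic there. [cite: SalmhoferSeiler1991, Thm. 3.8] -/
theorem njl_thermodynamicLimit_succ {N : ℕ} (hN : 1 ≤ N) (hν : 1 ≤ ν) (d : Site ν →₀ ℕ) :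
    ∃ f : ℂ → ℂ, DifferentiableOn ℂ f (njlMassRegion ν) ∧
      TendstoLocallyUniformlyOn (fun L : ℕ => njlCorrelation N (L + 1) d) f atTop (njlMassRegion ν) := by
  obtain ⟨f, hf, h⟩ := njl_thermodynamicLimit hN hν d
  exact ⟨f, hf, h (fun L => L + 1) (tendsto_add_atTop_nat 1)⟩

/-- **Theorem 3.8 (2): the thermodynamic limit is analytic in the mass** on
`ℂ ∖ i[-√(2ν), √(2ν)] ⊇ 𝒲`. [cite: SalmhoferSeiler1991, Thm. 3.8 (2)] -/
theorem njl_thermodynamicLimit_analyticOnNhd {N : ℕ} (hN : 1 ≤ N) (hν : 1 ≤ ν) (d : Site ν →₀ ℕ) :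
    ∃ f : ℂ → ℂ, AnalyticOnNhd ℂ f (njlMassRegion ν) ∧
      ∀ (Ls : ℕ → ℕ) [∀ j, NeZero (Ls j)], Tendsto Ls atTop atTop →
        ∀ m ∈ njlMassRegion ν, Tendsto (fun j => njlCorrelation N (Ls j) d m) atTop (𝓝 (f m)) := by
  obtain ⟨f, hf, h⟩ := njl_thermodynamicLimit hN hν d
  exact ⟨f, (hf.analyticOnNhd isOpen_njlMassRegion), fun Ls _ hLs m hm => (h Ls hLs).tendsto_at hm⟩

/-- **Theorem 3.8 on the printed region `𝒲 = ℂ ∖ 2i[-√(2νN), √(2νN)]`.** [cite: SalmhoferSeiler1991, Thm. 3.8] -/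
theorem njl_thermodynamicLimit_printedRegion {N : ℕ} (hN : 1 ≤ N) (hν : 1 ≤ ν) (d : Site ν →₀ ℕ) :
    ∃ f : ℂ → ℂ, DifferentiableOn ℂ f {m : ℂ | ¬ (m.re = 0 ∧ |m.im| ≤ 2 * Real.sqrt (2 * ν * N))} ∧
      ∀ (Ls : ℕ → ℕ) [∀ j, NeZero (Ls j)], Tendsto Ls atTop atTop →
        ∀ m : ℂ, ¬ (m.re = 0 ∧ |m.im| ≤ 2 * Real.sqrt (2 * ν * N)) →
          Tendsto (fun j => njlCorrelation N (Ls j) d m) atTop (𝓝 (f m)) := by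
  obtain ⟨f, hf, h⟩ := njl_thermodynamicLimit hN hν d
  refine ⟨f, hf.mono fun m hm => printedRegion_subset_njlMassRegion hN hm, fun Ls _ hLs m hm =>
    (h Ls hLs).tendsto_at (printedRegion_subset_njlMassRegion hN hm)⟩

/-- **Corollary 3.9 (Salmhofer–Seiler), torus version.**  For every REAL mass `m ≠ 0` (both signs)
and every multi-index, the thermodynamic limit `lim_{L→∞} ⟨σ^d⟩_{Λ_L}(m)` exists along every
sequence of tori and is the value at `m` of a function holomorphic on `ℂ ∖ i[-√(2ν), √(2ν)]` — the
correlation functions are real-analytic in `m` on `ℝ ∖ {0}`: "a phase transition can occur in a NJL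
model only if `m = 0`". [cite: SalmhoferSeiler1991, Cor. 3.9] -/
theorem njl_thermodynamicLimit_real {N : ℕ} (hN : 1 ≤ N) (hν : 1 ≤ ν) (d : Site ν →₀ ℕ) :
    ∃ f : ℂ → ℂ, DifferentiableOn ℂ f (njlMassRegion ν) ∧
      ∀ (Ls : ℕ → ℕ) [∀ j, NeZero (Ls j)], Tendsto Ls atTop atTop →
        ∀ m : ℝ, m ≠ 0 → Tendsto (fun j => njlCorrelation N (Ls j) d (m : ℂ)) atTop (𝓝 (f m)) := by
  obtain ⟨f, hf, h⟩ := njl_thermodynamicLimit hN hν d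
  refine ⟨f, hf, fun Ls _ hLs m hm => (h Ls hLs).tendsto_at (Or.inl ?_)⟩
  rwa [Complex.ofReal_re]

/-- **Corollary 3.9 in the tree's real vocabulary**: for real `m ≠ 0` the tree's NJL expectations
`expect N m njlBondCoeff (σ^d)` on the tori `(ℤ/(L+1)ℤ)^ν` converge as `L → ∞`. [cite: SalmhoferSeiler1991, Cor. 3.9] -/
theorem njl_tendsto_expect_monomial {N : ℕ} (hN : 1 ≤ N) (hν : 1 ≤ ν) (d : Site ν →₀ ℕ) {m : ℝ}
    (hm : m ≠ 0) :
    ∃ c : ℝ, Tendsto (fun L : ℕ =>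
      expect (ν := ν) (L := L + 1) N m (njlBondCoeff N)
        (MvPolynomial.monomial (Finsupp.mapDomain (Torus.proj (L + 1)) d) (1 : ℝ))) atTop (𝓝 c) := by
  obtain ⟨f, -, h⟩ := njl_thermodynamicLimit_real hN hν d
  have ht := h (fun L => L + 1) (tendsto_add_atTop_nat 1) m hm
  -- the complex correlation at real mass is the real expectation
  have hre : ∀ L : ℕ, njlCorrelation N (L + 1) d (m : ℂ) =
      ((expect (ν := ν) (L := L + 1) N m (njlBondCoeff N)
        (MvPolynomial.monomial (Finsupp.mapDomain (Torus.proj (L + 1)) d) (1 : ℝ)) : ℝ) : ℂ) := by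
    intro L
    unfold njlCorrelation
    rw [← njlExpectC_ofReal]
    simp [MvPolynomial.map_monomial]
  refine ⟨(f m).re, ?_⟩
  have h2 := (Complex.continuous_re.tendsto _).comp ht
  refine h2.congr fun L => ?_
  simp only [Function.comp_apply, hre, Complex.ofReal_re]

end ComplexSpin

end Literature.MathematicalPhysics.StatisticalMechanics
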